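import Literature.NumberTheory.LFunctions.AndersonStarkLiouvilleProofs
import HarnessLib

/-!
# The Fresnel integrals of Anderson–Stark (17): the limits `C(∞) = S(∞) = ½`, bounds, and the kernel `k(y) = 2[C(√y) + S(√y) − 1]`

Topic `Literature/NumberTheory/LFunctions`. Everything in this file is PROVED. The tree's
`Literature/NumberTheory/LFunctions/AndersonStarkLiouville.lean` defines Fawaz's function `I(x)` of
Anderson–Stark's "proof by example" for `L(x) = ∑_{n ≤ x} λ(n)` (LNM 899 (1981), §4 (16)–(18)) by
the absolutely convergent series (17),
`I(x) = 1 + 2 ∑_{n ≥ 1} (c_n/n) [C(√(nx)) + S(√(nx)) − 1]`, with the Fresnel integrals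
`C(y) = ∫_0^y cos(πv²/2) dv`, `S(y) = ∫_0^y sin(πv²/2) dv` (`fresnelC`, `fresnelS`), and
`Literature/NumberTheory/LFunctions/AndersonStarkLiouvilleProofs.lean` proves the Fresnel value-and-
tail estimate `‖∫_0^y e^{iπv²/2} dv − (1+i)/2‖ ≤ 2/(πy)` (`norm_integral_cexp_fresnel_sub_le`) and
Anderson–Stark's `|C(y) + S(y) − 1| ≤ 2√2/(πy)` (`abs_fresnelC_add_fresnelS_sub_one_le`) on the way
to the bound (18). This short file records the consequences needed by the Mellin analysis of `I`
(Fawaz's evaluation of (16), used in the discharge of `AndersonStark1981_liouville_liminf` /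
`AndersonStark1981_liouville`):

* `tendsto_fresnelC_add_fresnelS_mul_I`, `tendsto_fresnelC`, `tendsto_fresnelS` — **the values
  `C(∞) = S(∞) = ½`** ((17): "`C(y) = ½ − ∫_y^∞ cos(πv²/2) dv`");
* continuity of `C`, `S` and the bounds `|C|, |S| ≤ 2` on `[0, ∞)`;
* `fawazKernel` — the kernel `k(y) = 2[C(√y) + S(√y) − 1]` of (17) (so that
  `I(x) = 1 + ∑ (c_n/n) k(nx)`), continuous, `= −2` on `(−∞, 0]`, with
  `|k(y)| ≤ 4√2/(π√y)` (`abs_fawazKernel_le`) and `|k| ≤ 10`.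

## References

* [AndersonStark1981] R. J. Anderson, H. M. Stark, *Oscillation theorems*, in: Analytic Number
  Theory (Philadelphia 1980), LNM 899, Springer 1981, 79–106 — §4, (17) and the paragraph after it
  (read in the LNM volume, `lit read book:editornd-analytic-number-theory`).
-/

noncomputable section

open Complex Filter MeasureTheory Set intervalIntegral
open scoped Real Topology

namespace Literature.NumberTheory.LFunctions

/-! ## The values `C(∞) = S(∞) = ½` -/

/-- The tree's Fresnel estimate in terms of `C` and `S`: `‖(C(y) + iS(y)) − (1+i)/2‖ ≤ 2/(πy)` for
`y > 0` (`norm_integral_cexp_fresnel_sub_le` and `integral_cexp_fresnel_eq`).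
[cite: AndersonStark1981, §4 (after (17))] -/
theorem norm_fresnelC_add_fresnelS_mul_I_sub_le {y : ℝ} (hy : 0 < y) :
    ‖((fresnelC y : ℂ) + fresnelS y * I) - (1 + I) / 2‖ ≤ 2 / (π * y) := by
  have h := norm_integral_cexp_fresnel_sub_le hy
  rwa [integral_cexp_fresnel_eq] at h

/-- `C(y) + iS(y) → (1+i)/2` as `y → ∞`. [cite: AndersonStark1981, §4 (17) (`C(y) = ½ − ∫_y^∞`, `S(y) = ½ − ∫_y^∞`)] -/
theorem tendsto_fresnelC_add_fresnelS_mul_I :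
    Tendsto (fun y : ℝ ↦ (fresnelC y : ℂ) + fresnelS y * I) atTop (𝓝 ((1 + I) / 2)) := by
  rw [tendsto_iff_norm_sub_tendsto_zero]
  have hlim : Tendsto (fun y : ℝ ↦ 2 / (π * y)) atTop (𝓝 0) := by
    have : (fun y : ℝ ↦ 2 / (π * y)) = fun y ↦ (2 / π) * y⁻¹ := by
      ext y; field_simp
    rw [this]
    simpa using tendsto_inv_atTop_zero.const_mul (2 / π)
  refine squeeze_zero' (Eventually.of_forall fun y ↦ norm_nonneg _) ?_ hlim
  filter_upwards [eventually_gt_atTop 0] with y hy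
  exact norm_fresnelC_add_fresnelS_mul_I_sub_le hy

/-- `C(y) → ½`. [cite: AndersonStark1981, §4 (17)] -/
theorem tendsto_fresnelC : Tendsto fresnelC atTop (𝓝 (1 / 2)) := by
  have h := (Complex.continuous_re.tendsto _).comp tendsto_fresnelC_add_fresnelS_mul_I
  have h1 : ((1 + I) / 2 : ℂ).re = 1 / 2 := by norm_num
  rw [h1] at h
  refine h.congr fun y ↦ ?_
  simp

/-- `S(y) → ½`. [cite: AndersonStark1981, §4 (17)] -/
theorem tendsto_fresnelS : Tendsto fresnelS atTop (𝓝 (1 / 2)) := by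
  have h := (Complex.continuous_im.tendsto _).comp tendsto_fresnelC_add_fresnelS_mul_I
  have h1 : ((1 + I) / 2 : ℂ).im = 1 / 2 := by norm_num
  rw [h1] at h
  refine h.congr fun y ↦ ?_
  simp

/-! ## Continuity and bounds -/

/-- `C` is continuous. [folklore] -/
theorem continuous_fresnelC : Continuous fresnelC := by
  unfold fresnelC
  exact intervalIntegral.continuous_primitive (fun a b ↦ Continuous.intervalIntegrable (by fun_prop) _ _) 0

/-- `S` is continuous. [folklore] -/
theorem continuous_fresnelS : Continuous fresnelS := by
  unfold fresnelS
  exact intervalIntegral.continuous_primitive (fun a b ↦ Continuous.intervalIntegrable (by fun_prop) _ _) 0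

/-- `‖C(y) + iS(y)‖ ≤ y` for `y ≥ 0` (the integrand has modulus one). [folklore] -/
theorem norm_fresnel_le_self {y : ℝ} (hy : 0 ≤ y) : ‖(fresnelC y : ℂ) + fresnelS y * I‖ ≤ y := by
  rw [← integral_cexp_fresnel_eq]
  have := intervalIntegral.norm_integral_le_of_norm_le_const (a := (0 : ℝ)) (b := y) (C := 1)
    (f := fun v : ℝ ↦ cexp (((π * v ^ 2 / 2 : ℝ) : ℂ) * I)) (fun v _ ↦ by
      rw [Complex.norm_exp_ofReal_mul_I])
  simpa [abs_of_nonneg hy] using this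

/-- `‖C(y) + iS(y)‖ ≤ 2` for `y ≥ 0`. [folklore] -/
theorem norm_fresnel_le_two {y : ℝ} (hy : 0 ≤ y) : ‖(fresnelC y : ℂ) + fresnelS y * I‖ ≤ 2 := by
  rcases le_or_gt y 1 with h1 | h1
  · exact (norm_fresnel_le_self hy).trans (by linarith)
  · have hy0 : 0 < y := by linarith
    have ht := norm_fresnelC_add_fresnelS_mul_I_sub_le hy0
    have hπ : 2 / (π * y) ≤ 1 := by
      rw [div_le_one (by positivity)]
      nlinarith [Real.pi_gt_three]
    have hc : ‖((1 + I) / 2 : ℂ)‖ ≤ 1 := by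
      rw [norm_div, Complex.norm_two]
      have : ‖(1 : ℂ) + I‖ ≤ 2 := by
        calc ‖(1 : ℂ) + I‖ ≤ ‖(1 : ℂ)‖ + ‖I‖ := norm_add_le _ _
          _ = 2 := by rw [norm_one, Complex.norm_I]; norm_num
      linarith
    calc ‖(fresnelC y : ℂ) + fresnelS y * I‖
        = ‖((fresnelC y : ℂ) + fresnelS y * I - (1 + I) / 2) + (1 + I) / 2‖ := by ring_nf
      _ ≤ ‖(fresnelC y : ℂ) + fresnelS y * I - (1 + I) / 2‖ + ‖((1 + I) / 2 : ℂ)‖ := norm_add_le _ _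
      _ ≤ 1 + 1 := add_le_add (ht.trans hπ) hc
      _ = 2 := by norm_num

/-- `|C(y)| ≤ 2` for `y ≥ 0`. [folklore] -/
theorem abs_fresnelC_le {y : ℝ} (hy : 0 ≤ y) : |fresnelC y| ≤ 2 := by
  have h := norm_fresnel_le_two hy
  have := Complex.abs_re_le_norm ((fresnelC y : ℂ) + fresnelS y * I)
  simp at this
  exact this.trans h

/-- `|S(y)| ≤ 2` for `y ≥ 0`. [folklore] -/
theorem abs_fresnelS_le {y : ℝ} (hy : 0 ≤ y) : |fresnelS y| ≤ 2 := by
  have h := norm_fresnel_le_two hy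
  have := Complex.abs_im_le_norm ((fresnelC y : ℂ) + fresnelS y * I)
  simp at this
  exact this.trans h

/-! ## The kernel `k(y) = 2[C(√y) + S(√y) − 1]` of Fawaz's series (17) -/

/-- **The kernel of Fawaz's series (17)**: `k(y) = 2[C(√y) + S(√y) − 1]`, so that
`I(x) = 1 + ∑_{n ≥ 1} (c_n/n) k(nx)` (`fawazI_eq_tsum_fawazKernel` in the file on the
coefficients). [cite: AndersonStark1981, §4 (17)] -/
def fawazKernel (y : ℝ) : ℝ := 2 * (fresnelC (Real.sqrt y) + fresnelS (Real.sqrt y) - 1)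

/-- Unfolding. [cite: AndersonStark1981, §4 (17)] -/
theorem fawazKernel_apply (y : ℝ) :
    fawazKernel y = 2 * (fresnelC (Real.sqrt y) + fresnelS (Real.sqrt y) - 1) := rfl

/-- `k` is continuous. [folklore] -/
theorem continuous_fawazKernel : Continuous fawazKernel := by
  unfold fawazKernel
  have h1 := continuous_fresnelC.comp Real.continuous_sqrt
  have h2 := continuous_fresnelS.comp Real.continuous_sqrt
  exact continuous_const.mul ((h1.add h2).sub continuous_const)

/-- `k(y) = −2` for `y ≤ 0` (`C(0) = S(0) = 0`). [folklore] -/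
theorem fawazKernel_of_nonpos {y : ℝ} (hy : y ≤ 0) : fawazKernel y = -2 := by
  rw [fawazKernel_apply, Real.sqrt_eq_zero'.2 hy, fresnelC_zero, fresnelS_zero]; norm_num

/-- **The tail bound for the kernel**: `|k(y)| ≤ 4√2/(π√y)` for `y > 0` (Anderson–Stark's
`|C(y) + S(y) − 1| ≤ 2√2/(πy)`, the tree's `abs_fresnelC_add_fresnelS_sub_one_le`, at `√y`).
[cite: AndersonStark1981, §4 (after (17))] -/
theorem abs_fawazKernel_le {y : ℝ} (hy : 0 < y) : |fawazKernel y| ≤ 4 * Real.sqrt 2 / (π * Real.sqrt y) := by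
  rw [fawazKernel_apply, abs_mul, abs_two]
  have h := abs_fresnelC_add_fresnelS_sub_one_le (Real.sqrt_pos.2 hy)
  calc 2 * |fresnelC (Real.sqrt y) + fresnelS (Real.sqrt y) - 1| ≤ 2 * (2 * Real.sqrt 2 / (π * Real.sqrt y)) :=
        by gcongr
    _ = 4 * Real.sqrt 2 / (π * Real.sqrt y) := by ring

/-- The crude uniform bound `|k(y)| ≤ 10`. [folklore] -/
theorem abs_fawazKernel_le_ten (y : ℝ) : |fawazKernel y| ≤ 10 := by
  rw [fawazKernel_apply, abs_mul, abs_two]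
  have h1 := abs_fresnelC_le (Real.sqrt_nonneg y)
  have h2 := abs_fresnelS_le (Real.sqrt_nonneg y)
  have h3 : |fresnelC (Real.sqrt y) + fresnelS (Real.sqrt y) - 1| ≤ 5 := by
    calc |fresnelC (Real.sqrt y) + fresnelS (Real.sqrt y) - 1|
        ≤ |fresnelC (Real.sqrt y) + fresnelS (Real.sqrt y)| + |(1 : ℝ)| := abs_sub _ _
      _ ≤ (|fresnelC (Real.sqrt y)| + |fresnelS (Real.sqrt y)|) + 1 := by
          gcongr
          · exact abs_add_le _ _
          · simp
      _ ≤ 5 := by linarith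
  linarith

end Literature.NumberTheory.LFunctions
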